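import Mathlib
import HarnessLib
import Summits.HubbardSuperconductivity.HubbardSuperconductivity.Theorems.KLProgrammeKLRegimeFlowPieceJetsAllOrders
import Summits.HubbardSuperconductivity.HubbardSuperconductivity.Theorems.KLProgrammeKLRegimeSplitSlotsV17F2

/-!
# K3 gen-8-FLOW (stmt 20437 `KLRegimeEngineV17F2`, stub (C), door (B)): the GEOMETRIC PIECE TABLE of the flow — `‖Dʲ evalM (klFlowPiece m)‖ ≤ A_j·4^{(j−2)m}`
# for EVERY `j ≤ 6` from the history's `(I-F jets)` (`j ≤ 4`) and reading jets (`j = 5, 6`, through the all-orders Jackson bound)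

Cell gate-hubbard-kl, seat p2 g12.  Door (B) (`…EngineFrameShiftMomentDoorFlow[Position]`) reads piece jet tables `pj m j'` for `j' ≤ r + 2 ≤ 6`; its side
conditions `hfit`/`hJ` are discharged by `…EngineFrameShiftPieceTables` from GEOMETRIC tables `pj m j ≤ A_j·4^{(j−2)m}`.  This file supplies that table from
the history of the V17F/V17F2 bundle: for `m ≤ n`,

* orders `j ≤ 4`: `FlowPieceJetsAt L M β U μ R m` verbatim (`A_j = R.Gfr j · uPow j U`);
* orders `j ≥ 5` (any `j ≥ 1` in fact): `TwoLegReadJetsF L M G Q β U μ m` (the `C⁴` reading jets of `ν_m(K_m)`) through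
  `…FlowPieceJetsAllOrders.norm_iteratedFDeriv_evalM_jacksonFrame_klFrameExtFn_le_all` at `d = klFlowDeg m = 2^7·4^m`, with `(d+1)^{j−1} ≤ 2^{8(j−1)}·4^{(j−1)m}`
  and `curveJetBar … U 1 m = (c̃₁ + c̃₁'|U|)·U²·4^{−m}`:  `A_j = 2^j·(π⁸/4)·2^{j−1}·2^{8(j−1)}·(curveExtC X G.S 1 + curveExtC X Q.S' 1·|U|)·U²`.

* **`flowPiece_jets_geometric`** — `∀ m ≤ n, ∀ j ≤ 6, ‖Dʲ evalM (klFlowPiece m)‖ ≤ A_j · 4^{(j−2)m}` with the explicit two-case `A_j` above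
  (hypotheses: `∀ m ≤ n, FlowPieceJetsAt … R m`, `∀ m ≤ n, TwoLegReadJetsF … m` — both inside `HistP klPredsV17F2 … (n+1)` via `histV17F2_of_histP` —,
  `μ ∈ klWindowC`, `G.S, Q.S' ≥ 0`, a sup `X` of the cutoff's derivatives of order `≤ 4`);
* `flowPiece_tableA_nonneg` — `0 ≤ A_j` (for `…PieceTables`' `hA`).

Proofs only; no definitions (the table is written out); nothing about the sizes is asserted; nothing asserts superconductivity.
-/

noncomputable section

namespace Summit.HubbardSuperconductivity.HubbardSuperconductivity.Theorems.EngineV8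

set_option linter.dupNamespace false -- summit = problem name (single-conjunct summit), D-0017

open Finset Literature.MathematicalPhysics.QuantumLattice Literature.Probability.LatticeModels
open Summit.HubbardSuperconductivity.HubbardSuperconductivity.Theorems.KLRegimeSplit
open scoped Nat

variable {L M : ℕ} [NeZero L] [NeZero M]

omit [NeZero L] [NeZero M] in
/-- The degree schedule against a clean power: `klFlowDeg m + 1 ≤ 2^8 · 4^m`. -/
theorem klFlowDeg_add_one_le (m : ℕ) : ((klFlowDeg m : ℕ) : ℝ) + 1 ≤ (2 : ℝ) ^ 8 * (4 : ℝ) ^ m := by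
  unfold klFlowDeg
  push_cast
  have h : (1 : ℝ) ≤ (4 : ℝ) ^ m := one_le_pow₀ (by norm_num)
  nlinarith

omit [NeZero L] [NeZero M] in
/-- Collecting the powers of `4` in the high-order rows: `(4^m)^{j−1} · 4^{(1−2)m} = 4^{(j−2)m}` for `1 ≤ j`. -/
theorem four_pow_pred_mul_zpow {j : ℕ} (hj : 1 ≤ j) (m : ℕ) :
    ((4 : ℝ) ^ m) ^ (j - 1) * (4 : ℝ) ^ ((((1 : ℕ) : ℤ) - 2) * m) = (4 : ℝ) ^ (((j : ℤ) - 2) * m) := by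
  have h4 : (4 : ℝ) ≠ 0 := by norm_num
  rw [← pow_mul, ← zpow_natCast, ← zpow_add₀ h4]
  congr 1
  push_cast [Nat.cast_sub hj]
  ring

omit [NeZero L] [NeZero M] in
/-- **The geometric table is non-negative** (for `R.Gfr ≥ 0`, `G.S, Q.S' ≥ 0`, `X ≥ 0`). -/
theorem flowPiece_tableA_nonneg {G : GeoConsts} {Q : EngConsts} {R : RenConsts} (hR : ∀ j, 0 ≤ R.Gfr j) (hGS : ∀ k, 0 ≤ G.S k)
    (hQS : ∀ k, 0 ≤ Q.S' k) {X : ℝ} (hX0 : 0 ≤ X) (U : ℝ) (j : ℕ) :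
    0 ≤ (if j ≤ 4 then R.Gfr j * uPow j U
      else 2 ^ j * (Real.pi ^ 8 / 4 * 2 ^ (j - 1) * (2 : ℝ) ^ (8 * (j - 1))) *
        ((curveExtC X G.S 1 + curveExtC X Q.S' 1 * |U|) * U ^ 2)) := by
  split_ifs with hj
  · have hu : 0 ≤ uPow j U := by unfold uPow; split_ifs <;> positivity
    exact mul_nonneg (hR j) hu
  · have h1 := curveExtC_nonneg hX0 hGS 1
    have h2 := curveExtC_nonneg hX0 hQS 1
    positivity

/-- **THE GEOMETRIC PIECE TABLE OF THE FLOW, ORDERS `≤ 6`**: for `m ≤ n` and `j ≤ 6`, `‖Dʲ evalM (klFlowPiece m)‖ ≤ A_j · 4^{(j−2)m}` with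
`A_j = R.Gfr j · uPow j U` (`j ≤ 4`, the `(I-F jets)` verbatim) and `A_j = 2^j·(π⁸/4)·2^{j−1}·2^{8(j−1)}·(curveExtC X G.S 1 + curveExtC X Q.S' 1·|U|)·U²`
(`j = 5, 6`, from the reading jets of `ν_m(K_m)` through the all-orders Jackson bound at `d = klFlowDeg m`). -/
theorem flowPiece_jets_geometric {G : GeoConsts} {Q : EngConsts} {R : RenConsts} (hGS : ∀ k, 0 ≤ G.S k) (hQS : ∀ k, 0 ≤ Q.S' k)
    {β U μ : ℝ} (hμ : μ ∈ klWindowC) {X : ℝ} (hX : ∀ l ≤ 4, ∀ x : ℝ, ‖iteratedFDeriv ℝ l salmhoferCutoff x‖ ≤ X)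
    {n : ℕ} (hP : ∀ m ≤ n, FlowPieceJetsAt L M β U μ R m) (hT : ∀ m ≤ n, TwoLegReadJetsF L M G Q β U μ m) :
    ∀ m ≤ n, ∀ j ≤ 6, ∀ q : Momentum, ‖iteratedFDeriv ℝ j (evalM (klFlowPiece L M β U μ m)) q‖ ≤
      (if j ≤ 4 then R.Gfr j * uPow j U
        else 2 ^ j * (Real.pi ^ 8 / 4 * 2 ^ (j - 1) * (2 : ℝ) ^ (8 * (j - 1))) *
          ((curveExtC X G.S 1 + curveExtC X Q.S' 1 * |U|) * U ^ 2)) * (4 : ℝ) ^ (((j : ℤ) - 2) * m) := by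
  intro m hm j hj q
  by_cases hj4 : j ≤ 4
  · rw [if_pos hj4]
    exact hP m hm j hj4 q
  · rw [if_neg hj4]
    have hj1 : 1 ≤ j := by omega
    have hX0 : 0 ≤ X := (norm_nonneg _).trans (hX 0 (by norm_num) 0)
    obtain ⟨hν, hjet⟩ := hT m hm
    have hpiece : klFlowPiece L M β U μ m =
        jacksonFrame (klFlowDeg m) (klFrameExtFn μ (klLocalPart L M β U μ (klFlowFrameU L M β U μ m) m)) := rfl
    have h := norm_iteratedFDeriv_evalM_jacksonFrame_klFrameExtFn_le_all (L := L) (M := M) hGS hQS hμ hν hjet hX (klFlowDeg m) hj1 q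
    rw [hpiece]
    refine h.trans ?_
    have hcjb : curveJetBar (curveExtC X G.S) (curveExtC X Q.S') U 1 m =
        (curveExtC X G.S 1 + curveExtC X Q.S' 1 * |U|) * U ^ 2 * (4 : ℝ) ^ ((((1 : ℕ) : ℤ) - 2) * m) := by
      rw [curveJetBar_apply]
      simp [uPow]
    have hcjb0 : 0 ≤ (curveExtC X G.S 1 + curveExtC X Q.S' 1 * |U|) * U ^ 2 :=
      mul_nonneg (add_nonneg (curveExtC_nonneg hX0 hGS 1) (mul_nonneg (curveExtC_nonneg hX0 hQS 1) (abs_nonneg U))) (sq_nonneg U)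
    have hdeg : ((klFlowDeg m : ℕ) : ℝ) + 1 ≤ (2 : ℝ) ^ 8 * (4 : ℝ) ^ m := klFlowDeg_add_one_le m
    have hdegpow : (((klFlowDeg m : ℕ) : ℝ) + 1) ^ (j - 1) ≤ ((2 : ℝ) ^ 8 * (4 : ℝ) ^ m) ^ (j - 1) :=
      pow_le_pow_left₀ (by positivity) hdeg _
    rw [hcjb]
    calc 2 ^ j * (Real.pi ^ 8 / 4 * 2 ^ (j - 1) * (((klFlowDeg m : ℕ) : ℝ) + 1) ^ (j - 1) *
          ((curveExtC X G.S 1 + curveExtC X Q.S' 1 * |U|) * U ^ 2 * (4 : ℝ) ^ ((((1 : ℕ) : ℤ) - 2) * m)))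
        ≤ 2 ^ j * (Real.pi ^ 8 / 4 * 2 ^ (j - 1) * ((2 : ℝ) ^ 8 * (4 : ℝ) ^ m) ^ (j - 1) *
          ((curveExtC X G.S 1 + curveExtC X Q.S' 1 * |U|) * U ^ 2 * (4 : ℝ) ^ ((((1 : ℕ) : ℤ) - 2) * m))) := by
          have hz : 0 ≤ (4 : ℝ) ^ ((((1 : ℕ) : ℤ) - 2) * m) := zpow_nonneg (by norm_num) _
          gcongr
      _ = 2 ^ j * (Real.pi ^ 8 / 4 * 2 ^ (j - 1) * (2 : ℝ) ^ (8 * (j - 1))) *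
          ((curveExtC X G.S 1 + curveExtC X Q.S' 1 * |U|) * U ^ 2) * (4 : ℝ) ^ (((j : ℤ) - 2) * m) := by
          rw [← four_pow_pred_mul_zpow hj1 m, mul_pow, ← pow_mul]
          ring

end Summit.HubbardSuperconductivity.HubbardSuperconductivity.Theorems.EngineV8

end
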